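import Literature.AlgebraicGeometry.ModuliOfAbelianVarieties.SiegelFamilyHeckeCorrespondenceIterate
import Literature.AlgebraicGeometry.ModuliOfAbelianVarieties.SiegelFamilyHeckeCorrespondenceDegreeSquarefree
import Literature.AlgebraicGeometry.ModuliOfAbelianVarieties.SiegelFamilyHeckeCorrespondenceSquareDegree
import HarnessLib

/-!
# `deg T(pn) ≤ deg T(p) · deg T(n)`, `deg T(p^k) ≤ (deg T(p))^k`, with strict inequality `deg T(p²) < (deg T(p))²`:
# the number of Lagrangian subgroups of `X_{Z'}[n]` is sub-multiplicative in `n`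

Layer `Literature/AlgebraicGeometry/ModuliOfAbelianVarieties`, namespace
`Literature.AlgebraicGeometry.ModuliOfAbelianVarieties.SiegelModuli`; lane `lit-hodgefound` (Track 2, Layer A4), seat
`lit-hodgefound-skel-4` (generation 56), row A4-205 of `run/shared/lean/pub/lit-hodgefound/SKELETON.md`.  Sequel of rows
A4-198 (`SiegelFamilyHeckeCorrespondenceProductDegree`: over every member of `T(n)(Z')` lie exactly `∏_{i=1}^{g}(pⁱ + 1)`
members of `T(pn)(Z')`; the degree sum rule), A4-200 (`…DegreeSquarefree`: equality `deg T(pn) = deg T(p) deg T(n)` for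
`p ∤ n`), A4-201 (`…SquareDegree`: the partition of the Lagrangians of `X_{Z'}[p²]` by type) and A4-204′ (`…Iterate`: every
member of `T(mn)(Z')` factors through `T(n)(Z')`).  «Lagrangian in `X_{Z'}[N]`» = `⊆ X_{Z'}[N]`, isotropic for `e_N`,
`#² = #X_{Z'}[N]` (rows A4-153 ∕ 155).  Consumed BY NAME: A4-153 `isLagrangian_ker_of_eq_smul`, A4-155
`isLagrangian_iff_exists_isIsogeny_ker_eq`, A4-198 `natCard_isLagrangian_ge_ker_eq_prod` ∕ `finite_isLagrangian` ∕
`sum_natCard_strata_mul_prod_eq_sq` ∕ `natCard_strata_zero_eq_one`, A4-200 `natCard_isLagrangian_eq_one`, A4-201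
`natCard_isLagrangian_sq_eq_sum_natCard_strata`, A4-204′ `exists_mem_heckeSet_factor`, the torus file's `ker_le_ker_mul`,
Mathlib's `Nat.card_le_card_of_injective`, `Nat.card_sigma`, `Finset.sum_lt_sum`, `Finset.single_le_prod'`.  THEOREMS
ONLY (D-0026: no definition, no instance, no named fact; net debt `0`).

## Sources, verbatim

* A. N. Andrianov, V. G. Zhuravlev, *Modular Forms and Hecke Operators* (1995) [held text
  `book:andrianov2015-modular-forms-hecke-operators`], Ch. 3 §1.1 (1.8) and Lemma 1.5 (p0098 L38 – p0099 L13) (`c(g, g'; h)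
  = v(g, g'; h)μ(g')μ(h)⁻¹`, so `Σ_h c μ(h) = μ(g)μ(g')`: the coset count `μ` of a product is the product, while the support
  of `(g)(g')` may consist of SEVERAL double cosets); §4 (4.80) (p0177 L22–L27): «`T(p)² = Σ_{i=0}^{n} a_i T_i(p²)`, where
  the `a_i` are nonnegative integers and `a_0 > 0`»; Thm. 3.23 (3.42) (p0143): `T(p²) = Σ_i T_i(p²)`.
* G. van der Geer, *Siegel modular forms and their applications* (2008), §16 (p0253 L21) (kernel description of `T(p)`,
  `T_i(p²)`).
* H. Lange, *Abelian Varieties over the Complex Numbers* (2023), §1.1.2 Prop. 1.1.13 (b) (p0022: «`deg(gf) = deg f · deg g`»),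
  §2.7.1 Cor. 2.7.3 (a) (p0149).

DEVIATION (said once).  The sources print the exact multiplicativity of the index `μ` and the relation (4.80) with
`a_0 > 0`; the file proves the KERNEL-COUNT inequalities they imply on the Siegel family: since every Lagrangian of
`X_{Z'}[pn]` contains at least one Lagrangian of `X_{Z'}[n]` (row A4-204′) and each of those lies in exactly `∏ (pⁱ + 1)`
of them (row A4-198), `#Lag X_{Z'}[pn] ≤ ∏ (pⁱ + 1) · #Lag X_{Z'}[n]`; and since `X_{Z'}[p]` (type `0`) contains all
`∏ (pⁱ + 1) > 1` Lagrangians of `X_{Z'}[p]` (`g ≥ 1`), the inequality is strict at `n = p`: `deg T(p²) < (deg T(p))²`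
(the coefficient `a_n = μ(T(p)) > 1` of `⟨p⟩ = T_n(p²)` in (4.80)).  No closed value of `deg T(p^k)` for `k ≥ 2`, `g ≥ 2` is
claimed.

## What is proved

* **`natCard_isLagrangian_mul_le`** (`#Lag X_{Z'}[pn] ≤ ∏_{i=1}^{g}(pⁱ + 1) · #Lag X_{Z'}[n]`, every `n ≥ 1`),
  **`natCard_isLagrangian_pow_le`** (`#Lag X_{Z'}[p^k] ≤ (∏_{i=1}^{g}(pⁱ + 1))^k`),
  **`natCard_isLagrangian_sq_lt_sq`** (`g ≥ 1`: `#Lag X_{Z'}[p²] < (∏_{i=1}^{g}(pⁱ + 1))²`, i.e. `deg T(p²) < (deg T(p))²`),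
  `natCard_isLagrangian_mul_self_lt` (the sub-multiplicativity is strict at `n = p`).

## References

* [AndrianovZhuravlev2015] A. N. Andrianov, V. G. Zhuravlev, *Modular Forms and Hecke Operators*, AMS (1995), Ch. 3 §1.1
  (1.8), Lemma 1.5 (p0098–p0099), Thm. 3.23 (3.42) (p0143), §4 (4.80) (p0177).
* [vanderGeer2008] G. van der Geer, in *The 1-2-3 of Modular Forms*, Springer (2008), §16 (p. 253 L21).
* [Lange2023AbelianVarietiesComplex] H. Lange, Springer (2023), §1.1.2 Prop. 1.1.13 (p0022), §2.7.1 Cor. 2.7.3 (a) (p0149).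
-/

noncomputable section

open Matrix Module Function Set
open scoped Matrix

namespace Literature.AlgebraicGeometry.ModuliOfAbelianVarieties

namespace SiegelModuli

open Literature.NumberTheory.Automorphic (siegelUpperHalfSpace)
open Literature.NumberTheory.ModularForms Literature.NumberTheory.ModularForms.SiegelUpperHalfSpace
open Literature.NumberTheory.ComplexMultiplication
open Literature.Geometry.Kaehler Literature.Geometry.Kaehler.ComplexTorus

variable {g : ℕ} (Z' : siegelUpperHalfSpace g) {p : ℕ} [hp : Fact p.Prime] {n : ℕ}

/-- **`deg T(pn) ≤ deg T(p) · deg T(n)` ON THE KERNELS: `#Lag X_{Z'}[pn] ≤ ∏_{i=1}^{g}(pⁱ + 1) · #Lag X_{Z'}[n]`** for every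
`n ≥ 1` — `K ↦ (K₁, K)` with `K₁ ⊆ K` a Lagrangian of `X_{Z'}[n]` (one exists: every member of `T(pn)(Z')` factors through
`T(n)(Z')`, row A4-204′) injects the Lagrangians of `X_{Z'}[pn]` into the pairs, of which there are `∏ (pⁱ + 1) · #Lag X_{Z'}[n]`
(row A4-198).  Equality holds iff `p ∤ n` (row A4-200; strictness at `n = p` below).
[cite: AndrianovZhuravlev2015, Ch. 3 §1.1 (1.8), Lemma 1.5 (p0098 L38 – p0099 L13)] [cite: vanderGeer2008, §16 (p. 253 L21)]
[cite: Lange2023AbelianVarietiesComplex, §1.1.2 Prop. 1.1.13 (b) (p0022) and §2.7.1 Cor. 2.7.3 (a) (p0149)] -/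
theorem natCard_isLagrangian_mul_le (hn : n ≠ 0) :
    Nat.card {K : AddSubgroup (ComplexTorus (prinPeriod Z' : (Fin g ⊕ Fin g → ℝ) ≃L[ℝ] (Fin g → ℂ))) //
        K ≤ (mapMatrixHom (prinPeriod Z') (prinPeriod Z')
          (((p * n : ℕ) : ℤ) • (1 : Matrix (Fin g ⊕ Fin g) (Fin g ⊕ Fin g) ℤ))).ker ∧
        (∀ s ∈ K, ∀ t ∈ K,
          weilPairing (prinPeriod Z' : (Fin g ⊕ Fin g → ℝ) ≃L[ℝ] (Fin g → ℂ)) (((p * n : ℕ) : ℝ) • prinForm Z') s t = 1) ∧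
        Nat.card K ^ 2 = Nat.card (mapMatrixHom (prinPeriod Z') (prinPeriod Z')
          (((p * n : ℕ) : ℤ) • (1 : Matrix (Fin g ⊕ Fin g) (Fin g ⊕ Fin g) ℤ))).ker} ≤
      (∏ i ∈ Finset.range g, (p ^ (i + 1) + 1)) *
        Nat.card {K₁ : AddSubgroup (ComplexTorus (prinPeriod Z' : (Fin g ⊕ Fin g → ℝ) ≃L[ℝ] (Fin g → ℂ))) //
          K₁ ≤ (mapMatrixHom (prinPeriod Z') (prinPeriod Z') ((n : ℤ) • (1 : Matrix (Fin g ⊕ Fin g) (Fin g ⊕ Fin g) ℤ))).ker ∧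
          (∀ s ∈ K₁, ∀ t ∈ K₁,
            weilPairing (prinPeriod Z' : (Fin g ⊕ Fin g → ℝ) ≃L[ℝ] (Fin g → ℂ)) ((n : ℝ) • prinForm Z') s t = 1) ∧
          Nat.card K₁ ^ 2 = Nat.card (mapMatrixHom (prinPeriod Z') (prinPeriod Z')
            ((n : ℤ) • (1 : Matrix (Fin g ⊕ Fin g) (Fin g ⊕ Fin g) ℤ))).ker} := by
  classical
  have hp0 : p ≠ 0 := hp.out.ne_zero
  haveI := finite_isLagrangian Z' hn
  haveI := finite_isLagrangian Z' (mul_ne_zero hp0 hn)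
  letI := Fintype.ofFinite {K₁ : AddSubgroup (ComplexTorus (prinPeriod Z' : (Fin g ⊕ Fin g → ℝ) ≃L[ℝ] (Fin g → ℂ))) //
    K₁ ≤ (mapMatrixHom (prinPeriod Z') (prinPeriod Z') ((n : ℤ) • (1 : Matrix (Fin g ⊕ Fin g) (Fin g ⊕ Fin g) ℤ))).ker ∧
    (∀ s ∈ K₁, ∀ t ∈ K₁,
      weilPairing (prinPeriod Z' : (Fin g ⊕ Fin g → ℝ) ≃L[ℝ] (Fin g → ℂ)) ((n : ℝ) • prinForm Z') s t = 1) ∧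
    Nat.card K₁ ^ 2 = Nat.card (mapMatrixHom (prinPeriod Z') (prinPeriod Z')
      ((n : ℤ) • (1 : Matrix (Fin g ⊕ Fin g) (Fin g ⊕ Fin g) ℤ))).ker}
  -- every Lagrangian of `X[pn]` contains a Lagrangian of `X[n]`
  have key : ∀ K : {K : AddSubgroup (ComplexTorus (prinPeriod Z' : (Fin g ⊕ Fin g → ℝ) ≃L[ℝ] (Fin g → ℂ))) //
      K ≤ (mapMatrixHom (prinPeriod Z') (prinPeriod Z')
        (((p * n : ℕ) : ℤ) • (1 : Matrix (Fin g ⊕ Fin g) (Fin g ⊕ Fin g) ℤ))).ker ∧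
      (∀ s ∈ K, ∀ t ∈ K,
        weilPairing (prinPeriod Z' : (Fin g ⊕ Fin g → ℝ) ≃L[ℝ] (Fin g → ℂ)) (((p * n : ℕ) : ℝ) • prinForm Z') s t = 1) ∧
      Nat.card K ^ 2 = Nat.card (mapMatrixHom (prinPeriod Z') (prinPeriod Z')
        (((p * n : ℕ) : ℤ) • (1 : Matrix (Fin g ⊕ Fin g) (Fin g ⊕ Fin g) ℤ))).ker},
      ∃ K₁ : {K₁ : AddSubgroup (ComplexTorus (prinPeriod Z' : (Fin g ⊕ Fin g → ℝ) ≃L[ℝ] (Fin g → ℂ))) //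
        K₁ ≤ (mapMatrixHom (prinPeriod Z') (prinPeriod Z') ((n : ℤ) • (1 : Matrix (Fin g ⊕ Fin g) (Fin g ⊕ Fin g) ℤ))).ker ∧
        (∀ s ∈ K₁, ∀ t ∈ K₁,
          weilPairing (prinPeriod Z' : (Fin g ⊕ Fin g → ℝ) ≃L[ℝ] (Fin g → ℂ)) ((n : ℝ) • prinForm Z') s t = 1) ∧
        Nat.card K₁ ^ 2 = Nat.card (mapMatrixHom (prinPeriod Z') (prinPeriod Z')
          ((n : ℤ) • (1 : Matrix (Fin g ⊕ Fin g) (Fin g ⊕ Fin g) ℤ))).ker}, K₁.1 ≤ K.1 := fun K ↦ by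
    obtain ⟨Z, A, hA, hker, hq⟩ := (isLagrangian_iff_exists_isIsogeny_ker_eq (mul_ne_zero hp0 hn)).1 K.2
    obtain ⟨Z₁, B, C, hB, hqB, -, -, hCB⟩ := exists_mem_heckeSet_factor n hp0 hn hA hq
    refine ⟨⟨(mapMatrixHom (prinPeriod Z') (prinPeriod Z₁) B).ker, isLagrangian_ker_of_eq_smul hn hB hqB⟩, ?_⟩
    change (mapMatrixHom (prinPeriod Z') (prinPeriod Z₁) B).ker ≤ K.1
    rw [← hker, ← hCB]
    exact ker_le_ker_mul _ _ _ C B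
  choose f hf using key
  calc Nat.card _ ≤ Nat.card (Σ K₁ : {K₁ : AddSubgroup (ComplexTorus (prinPeriod Z' : (Fin g ⊕ Fin g → ℝ) ≃L[ℝ] (Fin g → ℂ))) //
          K₁ ≤ (mapMatrixHom (prinPeriod Z') (prinPeriod Z') ((n : ℤ) • (1 : Matrix (Fin g ⊕ Fin g) (Fin g ⊕ Fin g) ℤ))).ker ∧
          (∀ s ∈ K₁, ∀ t ∈ K₁,
            weilPairing (prinPeriod Z' : (Fin g ⊕ Fin g → ℝ) ≃L[ℝ] (Fin g → ℂ)) ((n : ℝ) • prinForm Z') s t = 1) ∧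
          Nat.card K₁ ^ 2 = Nat.card (mapMatrixHom (prinPeriod Z') (prinPeriod Z')
            ((n : ℤ) • (1 : Matrix (Fin g ⊕ Fin g) (Fin g ⊕ Fin g) ℤ))).ker},
        {K : {K : AddSubgroup (ComplexTorus (prinPeriod Z' : (Fin g ⊕ Fin g → ℝ) ≃L[ℝ] (Fin g → ℂ))) //
          K ≤ (mapMatrixHom (prinPeriod Z') (prinPeriod Z')
            (((p * n : ℕ) : ℤ) • (1 : Matrix (Fin g ⊕ Fin g) (Fin g ⊕ Fin g) ℤ))).ker ∧
          (∀ s ∈ K, ∀ t ∈ K,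
            weilPairing (prinPeriod Z' : (Fin g ⊕ Fin g → ℝ) ≃L[ℝ] (Fin g → ℂ)) (((p * n : ℕ) : ℝ) • prinForm Z') s t = 1) ∧
          Nat.card K ^ 2 = Nat.card (mapMatrixHom (prinPeriod Z') (prinPeriod Z')
            (((p * n : ℕ) : ℤ) • (1 : Matrix (Fin g ⊕ Fin g) (Fin g ⊕ Fin g) ℤ))).ker} // K₁.1 ≤ K.1}) :=
        Nat.card_le_card_of_injective (fun K ↦ ⟨f K, ⟨K, hf K⟩⟩) fun K K' h ↦ congrArg (fun x ↦ x.2.1) h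
    _ = (∏ i ∈ Finset.range g, (p ^ (i + 1) + 1)) * Nat.card _ := by
      rw [Nat.card_sigma]
      refine (Finset.sum_const_nat (m := ∏ i ∈ Finset.range g, (p ^ (i + 1) + 1)) fun K₁ _ ↦ ?_).trans ?_
      · obtain ⟨Z₁, B, hB, hker, hqB⟩ := (isLagrangian_iff_exists_isIsogeny_ker_eq hn).1 K₁.2
        have h := natCard_isLagrangian_ge_ker_eq_prod (p := p) hn hB hqB
        rw [hker] at h
        rw [← h]
        exact Nat.card_congr
          { toFun := fun K ↦ ⟨K.1.1, K.1.2, K.2⟩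
            invFun := fun K ↦ ⟨⟨K.1, K.2.1⟩, K.2.2⟩
            left_inv := fun _ ↦ rfl
            right_inv := fun _ ↦ rfl }
      · rw [Finset.card_univ, ← Nat.card_eq_fintype_card, mul_comm]

/-- **`deg T(p^k) ≤ (deg T(p))^k` ON THE KERNELS: `#Lag X_{Z'}[p^k] ≤ (∏_{i=1}^{g}(pⁱ + 1))^k`** (induction on `k` with the
preceding inequality; `#Lag X_{Z'}[1] = 1`). [cite: AndrianovZhuravlev2015, Ch. 3 §1.1 (1.8), Lemma 1.5 (p0099) and §4 (4.80) (p0177)]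
[cite: vanderGeer2008, §16 (p. 253 L21)] -/
theorem natCard_isLagrangian_pow_le (k : ℕ) :
    Nat.card {K : AddSubgroup (ComplexTorus (prinPeriod Z' : (Fin g ⊕ Fin g → ℝ) ≃L[ℝ] (Fin g → ℂ))) //
        K ≤ (mapMatrixHom (prinPeriod Z') (prinPeriod Z')
          (((p ^ k : ℕ) : ℤ) • (1 : Matrix (Fin g ⊕ Fin g) (Fin g ⊕ Fin g) ℤ))).ker ∧
        (∀ s ∈ K, ∀ t ∈ K,
          weilPairing (prinPeriod Z' : (Fin g ⊕ Fin g → ℝ) ≃L[ℝ] (Fin g → ℂ)) (((p ^ k : ℕ) : ℝ) • prinForm Z') s t = 1) ∧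
        Nat.card K ^ 2 = Nat.card (mapMatrixHom (prinPeriod Z') (prinPeriod Z')
          (((p ^ k : ℕ) : ℤ) • (1 : Matrix (Fin g ⊕ Fin g) (Fin g ⊕ Fin g) ℤ))).ker} ≤
      (∏ i ∈ Finset.range g, (p ^ (i + 1) + 1)) ^ k := by
  induction k with
  | zero =>
    rw [pow_zero, pow_zero, natCard_isLagrangian_eq_one Z']
  | succ k ih =>
    rw [pow_succ', pow_succ']
    exact (natCard_isLagrangian_mul_le Z' (pow_ne_zero k hp.out.ne_zero)).trans (Nat.mul_le_mul_left _ ih)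

/-- **`deg T(p²) < (deg T(p))²` (`g ≥ 1`): `#Lag X_{Z'}[p²] < (∏_{i=1}^{g}(pⁱ + 1))²`** — in the degree sum rule
`Σ_k #{type k}·a_{g−k} = (deg T(p))²` (row A4-198) every `a_{g−k} ≥ 1` and the single Lagrangian `X_{Z'}[p]` of type `0`
carries `a_g = deg T(p) > 1`, while `Σ_k #{type k} = #Lag X_{Z'}[p²]` (row A4-201): the coefficient of `⟨p⟩ = T_n(p²)` in
«`T(p)² = Σ a_i T_i(p²)`» exceeds `1`. [cite: AndrianovZhuravlev2015, Ch. 3 §4 (4.80) (p0177 L22–L27) and Thm. 3.23 (3.42) (p0143)]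
[cite: vanderGeer2008, §16 (p. 253 L21)] -/
theorem natCard_isLagrangian_sq_lt_sq (hg : 1 ≤ g) :
    Nat.card {K : AddSubgroup (ComplexTorus (prinPeriod Z' : (Fin g ⊕ Fin g → ℝ) ≃L[ℝ] (Fin g → ℂ))) //
        K ≤ (mapMatrixHom (prinPeriod Z') (prinPeriod Z')
          (((p ^ 2 : ℕ) : ℤ) • (1 : Matrix (Fin g ⊕ Fin g) (Fin g ⊕ Fin g) ℤ))).ker ∧
        (∀ s ∈ K, ∀ t ∈ K,
          weilPairing (prinPeriod Z' : (Fin g ⊕ Fin g → ℝ) ≃L[ℝ] (Fin g → ℂ)) (((p ^ 2 : ℕ) : ℝ) • prinForm Z') s t = 1) ∧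
        Nat.card K ^ 2 = Nat.card (mapMatrixHom (prinPeriod Z') (prinPeriod Z')
          (((p ^ 2 : ℕ) : ℤ) • (1 : Matrix (Fin g ⊕ Fin g) (Fin g ⊕ Fin g) ℤ))).ker} <
      (∏ i ∈ Finset.range g, (p ^ (i + 1) + 1)) ^ 2 := by
  rw [natCard_isLagrangian_sq_eq_sum_natCard_strata (p := p) Z', ← sum_natCard_strata_mul_prod_eq_sq (p := p) Z']
  have hone : ∀ k, 1 ≤ ∏ i ∈ Finset.range (g - k), (p ^ (i + 1) + 1) := fun k ↦
    Nat.one_le_iff_ne_zero.2 (Finset.prod_ne_zero_iff.2 fun i _ ↦ Nat.succ_ne_zero _)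
  refine Finset.sum_lt_sum (fun k _ ↦ Nat.le_mul_of_pos_right _ (hone k)) ⟨0, Finset.mem_range.2 (Nat.succ_pos g), ?_⟩
  rw [natCard_strata_zero_eq_one, one_mul, Nat.sub_zero]
  calc 1 < p ^ (0 + 1) + 1 := by rw [zero_add, pow_one]; have := hp.out.one_lt; omega
    _ ≤ ∏ i ∈ Finset.range g, (p ^ (i + 1) + 1) :=
      Finset.single_le_prod' (f := fun i ↦ p ^ (i + 1) + 1) (fun i _ ↦ Nat.one_le_iff_ne_zero.2 (Nat.succ_ne_zero _))
        (Finset.mem_range.2 hg)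

/-- The sub-multiplicativity is STRICT at `n = p` (`g ≥ 1`): `#Lag X_{Z'}[p·p] < ∏ (pⁱ + 1) · #Lag X_{Z'}[p]`.
[cite: AndrianovZhuravlev2015, Ch. 3 §4 (4.80) (p0177 L22–L27)] [cite: vanderGeer2008, §16 (p. 253 L21)] -/
theorem natCard_isLagrangian_mul_self_lt (hg : 1 ≤ g) :
    Nat.card {K : AddSubgroup (ComplexTorus (prinPeriod Z' : (Fin g ⊕ Fin g → ℝ) ≃L[ℝ] (Fin g → ℂ))) //
        K ≤ (mapMatrixHom (prinPeriod Z') (prinPeriod Z')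
          (((p * p : ℕ) : ℤ) • (1 : Matrix (Fin g ⊕ Fin g) (Fin g ⊕ Fin g) ℤ))).ker ∧
        (∀ s ∈ K, ∀ t ∈ K,
          weilPairing (prinPeriod Z' : (Fin g ⊕ Fin g → ℝ) ≃L[ℝ] (Fin g → ℂ)) (((p * p : ℕ) : ℝ) • prinForm Z') s t = 1) ∧
        Nat.card K ^ 2 = Nat.card (mapMatrixHom (prinPeriod Z') (prinPeriod Z')
          (((p * p : ℕ) : ℤ) • (1 : Matrix (Fin g ⊕ Fin g) (Fin g ⊕ Fin g) ℤ))).ker} <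
      (∏ i ∈ Finset.range g, (p ^ (i + 1) + 1)) *
        Nat.card {K₁ : AddSubgroup (ComplexTorus (prinPeriod Z' : (Fin g ⊕ Fin g → ℝ) ≃L[ℝ] (Fin g → ℂ))) //
          K₁ ≤ (mapMatrixHom (prinPeriod Z') (prinPeriod Z') ((p : ℤ) • (1 : Matrix (Fin g ⊕ Fin g) (Fin g ⊕ Fin g) ℤ))).ker ∧
          (∀ s ∈ K₁, ∀ t ∈ K₁,
            weilPairing (prinPeriod Z' : (Fin g ⊕ Fin g → ℝ) ≃L[ℝ] (Fin g → ℂ)) ((p : ℝ) • prinForm Z') s t = 1) ∧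
          Nat.card K₁ ^ 2 = Nat.card (mapMatrixHom (prinPeriod Z') (prinPeriod Z')
            ((p : ℤ) • (1 : Matrix (Fin g ⊕ Fin g) (Fin g ⊕ Fin g) ℤ))).ker} := by
  rw [natCard_isLagrangian_eq_prod (p := p) Z', ← sq, ← sq]
  exact natCard_isLagrangian_sq_lt_sq Z' hg

end SiegelModuli

end Literature.AlgebraicGeometry.ModuliOfAbelianVarieties

end
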